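import Summits.Ventures.GridStability.Bench.WSCC9Deg2ASPdampH12RoaModel
import Summits.Ventures.GridStability.Models.RecastAngles
import Literature.Computation.Certificates.PolyIntervalEnclosure
import Mathlib.Analysis.SpecialFunctions.Trigonometric.Bounds
import Mathlib.Analysis.SpecialFunctions.Trigonometric.Inverse
import Mathlib.Analysis.Complex.Trigonometric
import HarnessLib

/-!
# WSCC9 «K-boxes»: rational boxes of STATES of the 3-machine model and a kernel test bounding a polynomial of the
# recast state on the box (natural interval extension) — the machinery of the «K ⊂ S» facts of LINE «G1cct-WSCC9-THRESH-K»

Venture GRIDFUSION, LINE «G1cct-WSCC9-THRESH-K» (lead g4 2026-08-27T07:24:26Z (2) «K ⊂ S_deg4 … in the kernel by the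
natural interval extension (σ_i, κ_i interval images of the angle box …; monomial-wise interval sum; ONE decide)»,
07:35:02Z (i), 07:45:26Z (b)); seat gridfusion-sos-3 (g4). Consumer: `Bench/WSCC9Deg4ASosgramDinstKbox.lean` (the point
form `K(1/12)`; the threshold rider's slice boxes reuse this file unchanged). Instance: «WSCC9-postB-SPdamp-h12»
(`Models/WSCC9.lean`, `WSCC9.postB_SPdamp : RecastData 2`), recast embedding
`deg2_A_SPdampH12_Z δs x = (sin u₂, 1 − cos u₂, sin u₃, 1 − cos u₃, v₁, v₂, v₃)` (gridfusion-lyap-1,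
`Bench/WSCC9Deg2ASPdampH12RoaModel.lean`; = model-1's `RecastData.embed`), `u_i = (δ_i − δ₁) − (δs_i − δs₁)`.

CONTENTS.
* §1 rational point enclosures `sinLoQ a ≤ sin a ≤ sinHiQ a` (`0 ≤ a ≤ 1`; Mathlib `Real.sin_ge_sub_cube`,
  `Real.sin_bound`) and `cosLoQ a ≤ cos a ≤ cosHiQ a` (`0 ≤ a ≤ 2`; half-angle `cos a = 1 − 2 sin²(a/2)`).
* §2 `KBox` = corners for `a₂ = δ₂ − δ₁ ∈ [a2lo, a2hi]`, `a₃ = δ₃ − δ₁ ∈ [a3lo, a3hi]` (ABSOLUTE relative angles, not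
  deviations) and `x.2 j ∈ [vlo j, vhi j]` (speed deviations in the instance frame `v = ω − ω∞′`); `KBox.toSet`; the
  recast 7-box `KBox.zbox` (variable order `σ₂, κ₂, σ₃, κ₃, v₁, v₂, v₃` = the certificates'). For EVERY `δs` with the A1
  relations `postB_SPdamp.EqData δs`: `sin u_i = c_i sin a_i − s_i cos a_i = sin (a_i − α_i^*)` and
  `cos u_i = cos (a_i − α_i^*)` with the CANONICAL angle `α_i^* = postB_SPdamp.angleOf i = arccos c_i ∈ [0, π/2]`
  (`sin_cos_u_eq`); hence on a box with `0 ≤ a_lo ≤ a_hi ≤ 1` and `c_i ≤ cosLoQ a_hi` (box below the equilibrium angle,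
  `u_i ≤ 0`) `σ_i` is increasing and `κ_i` decreasing in `a_i`, and the endpoint values are enclosed by §1
  (`sig_kap_mem`); intervals outward-rounded to dyadics (`NonemptyInterval.roundOut 60`). `KBox.sideOK` (the side
  conditions), `KBox.checkLe B V c` = `sideOK` ∧ right endpoint of `SOS.Poly.iencl (zbox B) V`
  (`Literature/Computation/Certificates/PolyIntervalEnclosure.lean`, Moore 1979 §3.3 Cor. 3.1) `≤ c` — ONE
  `decide +kernel` per box. SOUNDNESS: `KBox.Z_mem_zbox` (the recast state of every `x ∈ B` lies in `zbox B`,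
  coordinatewise in the `SOS.vars (List.ofFn ·)` assignment of the Bench decls), `KBox.eval_le_of_checkLe`
  (`checkLe B V c ⇒ V(Z δs x) ≤ c` on the box, any `δs` with `EqData δs`), `KBox.abs_u_lt_pi` (on a side-OK box,
  `|u_i| < π` for the canonical angles — the no-pole-slip-window hypothesis of the `…RoaModel` theorems).

THREE COLUMNS: CERTIFIED = these kernel lemmas (pure inequalities); nothing VALIDATED; MODELLED = the classical WSCC9
instance «WSCC9-postB-SPdamp-h12» (MV-2 + MV-P + MV-SPD + MV-ω + MV-h12). No sentence here says a grid is stable.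
Exact Python mirror of the arithmetic (for referees): HOME/cert/sos-3/kbox/kbox_mirror.py.
-/

noncomputable section

open Real Set Filter Topology
open Literature.Computation.Certificates Literature.Computation.Certificates.SOS
open Summit.Ventures.GridStability.Models Summit.Ventures.GridStability.Lyapunov

namespace Summit.Ventures.GridStability.Bench.WSCC9

/-! ### §1 Rational point enclosures of `sin` / `cos` on `[0, 1]` (resp. `[0, 2]`) -/

/-- Taylor lower bound of `sin a`, `a ≥ 0`: `a − a³/6`. [folklore] -/
def sinLoQ (a : ℚ) : ℚ := a - a ^ 3 / 6

/-- Upper bound of `sin a`, `0 ≤ a ≤ 1`: `a − a³/6 + a⁵/100` (Mathlib `Real.sin_bound`). [folklore] -/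
def sinHiQ (a : ℚ) : ℚ := a - a ^ 3 / 6 + a ^ 5 / 100

/-- Upper bound of `cos a`, `0 ≤ a ≤ 2`: `1 − 2·sinLoQ(a/2)²` (half-angle). [folklore] -/
def cosHiQ (a : ℚ) : ℚ := 1 - 2 * sinLoQ (a / 2) ^ 2

/-- Lower bound of `cos a`, `0 ≤ a ≤ 2`: `1 − 2·sinHiQ(a/2)²` (half-angle). [folklore] -/
def cosLoQ (a : ℚ) : ℚ := 1 - 2 * sinHiQ (a / 2) ^ 2

/-- `sinLoQ a ≤ sin a` for `a ≥ 0` (`Real.sin_ge_sub_cube`). [folklore] -/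
theorem sinLoQ_le {a : ℚ} (h0 : 0 ≤ a) : (sinLoQ a : ℝ) ≤ sin a := by
  have h := Real.sin_ge_sub_cube (x := (a : ℝ)) (by exact_mod_cast h0)
  simp only [sinLoQ]; push_cast; linarith

/-- `sin a ≤ sinHiQ a` for `0 ≤ a ≤ 1` (`Real.sin_bound`). [folklore] -/
theorem le_sinHiQ {a : ℚ} (h0 : 0 ≤ a) (h1 : a ≤ 1) : sin a ≤ (sinHiQ a : ℝ) := by
  have ha0 : (0 : ℝ) ≤ a := by exact_mod_cast h0
  have ha1 : (a : ℝ) ≤ 1 := by exact_mod_cast h1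
  have h := Real.sin_bound (x := (a : ℝ)) (by rw [abs_of_nonneg ha0]; exact ha1)
  rw [abs_of_nonneg ha0] at h
  have h' := (abs_le.1 h).2
  simp only [sinHiQ]; push_cast; linarith

/-- `0 ≤ sinLoQ y` for `0 ≤ y ≤ 1`. [folklore] -/
theorem sinLoQ_nonneg {y : ℚ} (h0 : 0 ≤ y) (h1 : y ≤ 1) : 0 ≤ sinLoQ y := by
  simp only [sinLoQ]; nlinarith [mul_nonneg h0 h0, mul_nonneg (mul_nonneg h0 h0) h0]

/-- Half-angle identity `cos a = 1 − 2 sin²(a/2)`. [folklore] -/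
theorem cos_eq_one_sub_two_mul_sin_sq_half (a : ℝ) : cos a = 1 - 2 * sin (a / 2) ^ 2 := by
  have h2 : cos a = cos (2 * (a / 2)) := by ring_nf
  rw [h2, Real.cos_two_mul]
  nlinarith [Real.sin_sq_add_cos_sq (a / 2)]

/-- `cos a ≤ cosHiQ a` for `0 ≤ a ≤ 2`. [folklore] -/
theorem le_cosHiQ {a : ℚ} (h0 : 0 ≤ a) (h2 : a ≤ 2) : cos a ≤ (cosHiQ a : ℝ) := by
  have hy0 : (0 : ℚ) ≤ a / 2 := by linarith
  have hy1 : a / 2 ≤ (1 : ℚ) := by linarith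
  have hs : (sinLoQ (a / 2) : ℝ) ≤ sin ((a : ℝ) / 2) := by
    have := sinLoQ_le hy0; push_cast at this; exact this
  have hs0 : (0 : ℝ) ≤ sinLoQ (a / 2) := by exact_mod_cast sinLoQ_nonneg hy0 hy1
  rw [cos_eq_one_sub_two_mul_sin_sq_half]
  simp only [cosHiQ]; push_cast
  have hsq : (sinLoQ (a / 2) : ℝ) ^ 2 ≤ sin ((a : ℝ) / 2) ^ 2 := pow_le_pow_left₀ hs0 hs 2
  have e : ((a : ℝ) / 2) = ((a / 2 : ℚ) : ℝ) := by push_cast; ring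
  simp only [sinLoQ] at hsq; push_cast at hsq
  nlinarith [hsq]

/-- `cosLoQ a ≤ cos a` for `0 ≤ a ≤ 2`. [folklore] -/
theorem cosLoQ_le {a : ℚ} (h0 : 0 ≤ a) (h2 : a ≤ 2) : (cosLoQ a : ℝ) ≤ cos a := by
  have hy0 : (0 : ℚ) ≤ a / 2 := by linarith
  have hy1 : a / 2 ≤ (1 : ℚ) := by linarith
  have hs : sin ((a : ℝ) / 2) ≤ (sinHiQ (a / 2) : ℝ) := by
    have := le_sinHiQ hy0 hy1; push_cast at this; exact this
  have hsin0 : 0 ≤ sin ((a : ℝ) / 2) := by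
    apply Real.sin_nonneg_of_nonneg_of_le_pi
    · have : (0 : ℝ) ≤ a := by exact_mod_cast h0
      linarith
    · have : (a : ℝ) ≤ 2 := by exact_mod_cast h2
      linarith [Real.pi_gt_three]
  rw [cos_eq_one_sub_two_mul_sin_sq_half]
  simp only [cosLoQ]; push_cast
  have hsq : sin ((a : ℝ) / 2) ^ 2 ≤ (sinHiQ (a / 2) : ℝ) ^ 2 := pow_le_pow_left₀ hsin0 hs 2
  simp only [sinHiQ] at hsq; push_cast at hsq
  nlinarith [hsq]

/-! ### §2 K-boxes and their recast enclosure -/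

/-- A box of states of the 3-machine model: absolute relative angles `a₂ = δ₂ − δ₁`, `a₃ = δ₃ − δ₁` and the three
speed deviations of the post-fault instance (frame `v = ω − ω∞′`), rational corners. [folklore] -/
structure KBox where
  /-- lower corner of `a₂ = δ₂ − δ₁` -/
  a2lo : ℚ
  /-- upper corner of `a₂` -/
  a2hi : ℚ
  /-- lower corner of `a₃ = δ₃ − δ₁` -/
  a3lo : ℚ
  /-- upper corner of `a₃` -/
  a3hi : ℚ
  /-- lower corners of the speed deviations `x.2 j` (instance frame) -/
  vlo : Fin 3 → ℚ
  /-- upper corners of the speed deviations -/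
  vhi : Fin 3 → ℚ

namespace KBox

/-- The box as a set of states of the 3-machine model. [folklore] -/
def toSet (B : KBox) : Set (ClassicalSwing.State 3) :=
  {x | ((B.a2lo : ℝ) ≤ x.1 1 - x.1 0 ∧ x.1 1 - x.1 0 ≤ B.a2hi) ∧ ((B.a3lo : ℝ) ≤ x.1 2 - x.1 0 ∧ x.1 2 - x.1 0 ≤ B.a3hi) ∧
    ∀ j : Fin 3, (B.vlo j : ℝ) ≤ x.2 j ∧ x.2 j ≤ B.vhi j}

/-- Unfolding membership in `toSet`. [folklore] -/
theorem mem_toSet_iff (B : KBox) (x : ClassicalSwing.State 3) : x ∈ B.toSet ↔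
    (((B.a2lo : ℝ) ≤ x.1 1 - x.1 0 ∧ x.1 1 - x.1 0 ≤ B.a2hi) ∧ ((B.a3lo : ℝ) ≤ x.1 2 - x.1 0 ∧ x.1 2 - x.1 0 ≤ B.a3hi) ∧
    ∀ j : Fin 3, (B.vlo j : ℝ) ≤ x.2 j ∧ x.2 j ≤ B.vhi j) := Iff.rfl

/-- A rational interval from two endpoints in either order (`[min, max]`). [folklore] -/
def mkI (lo hi : ℚ) : NonemptyInterval ℚ := ⟨(min lo hi, max lo hi), min_le_max⟩

/-- Membership in `mkI lo hi` from `lo ≤ x ≤ hi`. [folklore] -/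
theorem mem_mkI {lo hi : ℚ} {x : ℝ} (h1 : (lo : ℝ) ≤ x) (h2 : x ≤ hi) : x ∈ (mkI lo hi).ratCast ℝ := by
  refine ⟨?_, ?_⟩
  · show (((mkI lo hi).fst : ℚ) : ℝ) ≤ x
    exact le_trans (by simp only [mkI]; exact_mod_cast min_le_left lo hi) h1
  · show x ≤ (((mkI lo hi).snd : ℚ) : ℝ)
    exact le_trans h2 (by simp only [mkI]; exact_mod_cast le_max_right lo hi)

/-- Enclosure of `σ = c sin a − s cos a = sin (a − α^*)` over `a ∈ [alo, ahi]` (increasing), dyadically rounded. [folklore] -/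
def sigI (s c alo ahi : ℚ) : NonemptyInterval ℚ :=
  (mkI (c * sinLoQ alo - s * cosHiQ alo) (c * sinHiQ ahi - s * cosLoQ ahi)).roundOut 60

/-- Enclosure of `κ = 1 − c cos a − s sin a = 1 − cos (a − α^*)` over `a ∈ [alo, ahi]` (decreasing), rounded. [folklore] -/
def kapI (s c alo ahi : ℚ) : NonemptyInterval ℚ :=
  (mkI (1 - c * cosHiQ ahi - s * sinHiQ ahi) (1 - c * cosLoQ alo - s * sinLoQ alo)).roundOut 60

/-- The recast 7-box of a K-box, variable order `(σ₂, κ₂, σ₃, κ₃, v₁, v₂, v₃)` = the certificate's. [folklore] -/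
def zbox (B : KBox) : List (NonemptyInterval ℚ) :=
  [sigI (WSCC9.postB_SPdamp.s 1) (WSCC9.postB_SPdamp.c 1) B.a2lo B.a2hi,
   kapI (WSCC9.postB_SPdamp.s 1) (WSCC9.postB_SPdamp.c 1) B.a2lo B.a2hi,
   sigI (WSCC9.postB_SPdamp.s 2) (WSCC9.postB_SPdamp.c 2) B.a3lo B.a3hi,
   kapI (WSCC9.postB_SPdamp.s 2) (WSCC9.postB_SPdamp.c 2) B.a3lo B.a3hi,
   mkI (B.vlo 0) (B.vhi 0), mkI (B.vlo 1) (B.vhi 1), mkI (B.vlo 2) (B.vhi 2)]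

/-- Side conditions making the enclosure sound: `0 ≤ a_lo ≤ a_hi ≤ 1` and `c_i ≤ cosLoQ a_hi` (the angle box lies
below the equilibrium angle `α_i^* = arccos c_i`, so `u_i ≤ 0`). [folklore] -/
def sideOK (B : KBox) : Bool :=
  decide (0 ≤ B.a2lo) && decide (B.a2lo ≤ B.a2hi) && decide (B.a2hi ≤ 1) &&
  decide (0 ≤ B.a3lo) && decide (B.a3lo ≤ B.a3hi) && decide (B.a3hi ≤ 1) &&
  decide (WSCC9.postB_SPdamp.c 1 ≤ cosLoQ B.a2hi) && decide (WSCC9.postB_SPdamp.c 2 ≤ cosLoQ B.a3hi)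

/-- The kernel test: side conditions and `sup` of the natural interval extension of `V` over the recast box `≤ c`. [folklore] -/
def checkLe (B : KBox) (V : Poly) (c : ℚ) : Bool :=
  B.sideOK && decide ((Poly.iencl B.zbox V).snd ≤ c)

/-! #### Soundness -/

/-- The circle points of machines 2, 3 are in the closed first quadrant and exact. [folklore] -/
theorem circle_facts :
    (0 ≤ WSCC9.postB_SPdamp.s 1 ∧ 0 ≤ WSCC9.postB_SPdamp.c 1 ∧ WSCC9.postB_SPdamp.s 1 ^ 2 + WSCC9.postB_SPdamp.c 1 ^ 2 = 1) ∧
    (0 ≤ WSCC9.postB_SPdamp.s 2 ∧ 0 ≤ WSCC9.postB_SPdamp.c 2 ∧ WSCC9.postB_SPdamp.s 2 ^ 2 + WSCC9.postB_SPdamp.c 2 ^ 2 = 1) := by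
  refine ⟨⟨?_, ?_, ?_⟩, ⟨?_, ?_, ?_⟩⟩ <;> decide +kernel

/-- The reference machine's canonical angle is `0`. [folklore] -/
theorem angleOf_zero : WSCC9.postB_SPdamp.angleOf 0 = 0 := by
  unfold RecastData.angleOf
  have hs : (0 : ℚ) ≤ WSCC9.postB_SPdamp.s 0 := by decide +kernel
  have hc : (WSCC9.postB_SPdamp.c 0 : ℝ) = 1 := by exact_mod_cast (by decide +kernel : WSCC9.postB_SPdamp.c 0 = 1)
  rw [if_pos hs, hc, Real.arccos_one]

/-- The canonical equilibrium angles of machines 2, 3 lie in `[0, π/2]`. [folklore] -/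
theorem angleOf_mem (i : Fin 2) :
    0 ≤ WSCC9.postB_SPdamp.angleOf i.succ ∧ WSCC9.postB_SPdamp.angleOf i.succ ≤ π / 2 ∧
      sin (WSCC9.postB_SPdamp.angleOf i.succ) = WSCC9.postB_SPdamp.s i.succ ∧
      cos (WSCC9.postB_SPdamp.angleOf i.succ) = WSCC9.postB_SPdamp.c i.succ ∧
      WSCC9.postB_SPdamp.angleOf i.succ = arccos (WSCC9.postB_SPdamp.c i.succ : ℝ) := by
  have key : ∀ j : Fin 3, 0 ≤ WSCC9.postB_SPdamp.s j → 0 ≤ WSCC9.postB_SPdamp.c j →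
      WSCC9.postB_SPdamp.s j ^ 2 + WSCC9.postB_SPdamp.c j ^ 2 = 1 →
      0 ≤ WSCC9.postB_SPdamp.angleOf j ∧ WSCC9.postB_SPdamp.angleOf j ≤ π / 2 ∧
        sin (WSCC9.postB_SPdamp.angleOf j) = WSCC9.postB_SPdamp.s j ∧
        cos (WSCC9.postB_SPdamp.angleOf j) = WSCC9.postB_SPdamp.c j ∧
        WSCC9.postB_SPdamp.angleOf j = arccos (WSCC9.postB_SPdamp.c j : ℝ) := by
    intro j hs hc hcirc
    have e : WSCC9.postB_SPdamp.angleOf j = arccos (WSCC9.postB_SPdamp.c j : ℝ) := by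
      unfold RecastData.angleOf; rw [if_pos hs]
    refine ⟨by rw [e]; exact Real.arccos_nonneg _, by rw [e]; exact Real.arccos_le_pi_div_two.2 (by exact_mod_cast hc),
      RecastData.sin_angleOf _ hcirc, RecastData.cos_angleOf _ hcirc, e⟩
  fin_cases i
  · exact key 1 circle_facts.1.1 circle_facts.1.2.1 circle_facts.1.2.2
  · exact key 2 circle_facts.2.1 circle_facts.2.2.1 circle_facts.2.2.2

/-- Under `EqData δs`, `sin u_i = sin (a_i − α_i^*)` and `cos u_i = cos (a_i − α_i^*)` with the CANONICAL angle
`α_i^* = postB_SPdamp.angleOf i` (whatever representative `δs` is). [folklore] -/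
theorem sin_cos_u_eq {δs : Fin 3 → ℝ} (hEq : WSCC9.postB_SPdamp.EqData δs) (x : ClassicalSwing.State 3) (i : Fin 2) :
    sin (RecastData.u δs x i.succ) = sin ((x.1 i.succ - x.1 0) - WSCC9.postB_SPdamp.angleOf i.succ) ∧
    cos (RecastData.u δs x i.succ) = cos ((x.1 i.succ - x.1 0) - WSCC9.postB_SPdamp.angleOf i.succ) := by
  obtain ⟨-, -, hsin, hcos, -⟩ := angleOf_mem i
  have hs := hEq.hs i.succ
  have hc := hEq.hc i.succ
  simp only [RecastData.u, Real.sin_sub, Real.cos_sub, ← hs, ← hc, hsin, hcos]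
  exact ⟨trivial, trivial⟩

/-- Monotone endpoint enclosure of `sin (a − α)` and `1 − cos (a − α)` for `a ∈ [alo, ahi] ⊂ [0, 1]`,
`α = arccos c ∈ [0, π/2]`, `sin α = s ≥ 0`, `c ≥ 0`, `c ≤ cosLoQ ahi`. [folklore] -/
theorem sig_kap_mem {s c alo ahi : ℚ} {α a : ℝ} (hs0 : 0 ≤ s) (hc0 : 0 ≤ c) (hα0 : 0 ≤ α) (hαπ : α ≤ π / 2)
    (hsin : sin α = s) (hcos : cos α = c) (hαe : α = arccos (c : ℝ))
    (h0 : 0 ≤ alo) (h01 : alo ≤ ahi) (h1 : ahi ≤ 1) (hcc : c ≤ cosLoQ ahi)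
    (ha1 : (alo : ℝ) ≤ a) (ha2 : a ≤ ahi) :
    sin (a - α) ∈ (sigI s c alo ahi).ratCast ℝ ∧ 1 - cos (a - α) ∈ (kapI s c alo ahi).ratCast ℝ := by
  have hπ := Real.pi_gt_three
  have halo0 : (0 : ℝ) ≤ alo := by exact_mod_cast h0
  have hahi1 : (ahi : ℝ) ≤ 1 := by exact_mod_cast h1
  have hs0' : (0 : ℝ) ≤ s := by exact_mod_cast hs0
  have hc0' : (0 : ℝ) ≤ c := by exact_mod_cast hc0
  have hahi0 : 0 ≤ ahi := le_trans h0 h01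
  have halo1 : alo ≤ 1 := le_trans h01 h1
  -- Taylor endpoint facts
  have sLlo := sinLoQ_le h0
  have sHlo := le_sinHiQ h0 halo1
  have cLlo := cosLoQ_le h0 (by linarith)
  have cHlo := le_cosHiQ h0 (by linarith)
  have sLhi := sinLoQ_le hahi0
  have sHhi := le_sinHiQ hahi0 h1
  have cLhi := cosLoQ_le hahi0 (by linarith)
  have cHhi := le_cosHiQ hahi0 (by linarith)
  -- α ≥ ahi (the box lies below the equilibrium angle)
  have hαhi : (ahi : ℝ) ≤ α := by
    rw [hαe]
    have h1' : arccos (cos (ahi : ℝ)) = ahi := Real.arccos_cos (by exact_mod_cast hahi0) (by linarith)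
    rw [← h1']
    apply Real.arccos_le_arccos
    exact le_trans (by exact_mod_cast hcc) cLhi
  -- monotonicity of sin on [−π/2, π/2]
  have m1 : sin ((alo : ℝ) - α) ≤ sin (a - α) :=
    Real.sin_le_sin_of_le_of_le_pi_div_two (by linarith) (by linarith) (by linarith)
  have m2 : sin (a - α) ≤ sin ((ahi : ℝ) - α) :=
    Real.sin_le_sin_of_le_of_le_pi_div_two (by linarith) (by linarith) (by linarith)
  -- monotonicity of cos on [−π, 0] (via cos (−z) on [0, π])
  have m3 : cos ((alo : ℝ) - α) ≤ cos (a - α) := by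
    rw [← Real.cos_neg ((alo : ℝ) - α), ← Real.cos_neg (a - α)]
    exact Real.cos_le_cos_of_nonneg_of_le_pi (by linarith) (by linarith) (by linarith)
  have m4 : cos (a - α) ≤ cos ((ahi : ℝ) - α) := by
    rw [← Real.cos_neg ((ahi : ℝ) - α), ← Real.cos_neg (a - α)]
    exact Real.cos_le_cos_of_nonneg_of_le_pi (by linarith) (by linarith) (by linarith)
  -- endpoint values through the subtraction formulas
  have elo : sin ((alo : ℝ) - α) = c * sin (alo : ℝ) - s * cos (alo : ℝ) := by rw [Real.sin_sub, hsin, hcos]; ring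
  have ehi : sin ((ahi : ℝ) - α) = c * sin (ahi : ℝ) - s * cos (ahi : ℝ) := by rw [Real.sin_sub, hsin, hcos]; ring
  have flo : cos ((alo : ℝ) - α) = c * cos (alo : ℝ) + s * sin (alo : ℝ) := by rw [Real.cos_sub, hsin, hcos]; ring
  have fhi : cos ((ahi : ℝ) - α) = c * cos (ahi : ℝ) + s * sin (ahi : ℝ) := by rw [Real.cos_sub, hsin, hcos]; ring
  constructor
  · apply NonemptyInterval.mem_roundOut
    apply mem_mkI
    · push_cast
      calc (c : ℝ) * sinLoQ alo - s * cosHiQ alo ≤ c * sin (alo : ℝ) - s * cos (alo : ℝ) := by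
            nlinarith [mul_le_mul_of_nonneg_left sLlo hc0', mul_le_mul_of_nonneg_left cHlo hs0']
        _ ≤ sin (a - α) := by rw [← elo]; exact m1
    · push_cast
      calc sin (a - α) ≤ c * sin (ahi : ℝ) - s * cos (ahi : ℝ) := by rw [← ehi]; exact m2
        _ ≤ (c : ℝ) * sinHiQ ahi - s * cosLoQ ahi := by
            nlinarith [mul_le_mul_of_nonneg_left sHhi hc0', mul_le_mul_of_nonneg_left cLhi hs0']
  · apply NonemptyInterval.mem_roundOut
    apply mem_mkI
    · push_cast
      calc (1 : ℝ) - c * cosHiQ ahi - s * sinHiQ ahi ≤ 1 - (c * cos (ahi : ℝ) + s * sin (ahi : ℝ)) := by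
            nlinarith [mul_le_mul_of_nonneg_left cHhi hc0', mul_le_mul_of_nonneg_left sHhi hs0']
        _ ≤ 1 - cos (a - α) := by rw [← fhi]; linarith [m4]
    · push_cast
      calc (1 : ℝ) - cos (a - α) ≤ 1 - (c * cos (alo : ℝ) + s * sin (alo : ℝ)) := by rw [← flo]; linarith [m3]
        _ ≤ 1 - (c : ℝ) * cosLoQ alo - s * sinLoQ alo := by
            nlinarith [mul_le_mul_of_nonneg_left cLlo hc0', mul_le_mul_of_nonneg_left sLlo hs0']

/-- Unpacking `sideOK`. [folklore] -/
theorem sideOK_spec {B : KBox} (h : B.sideOK = true) :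
    (0 ≤ B.a2lo ∧ B.a2lo ≤ B.a2hi ∧ B.a2hi ≤ 1) ∧ (0 ≤ B.a3lo ∧ B.a3lo ≤ B.a3hi ∧ B.a3hi ≤ 1) ∧
      WSCC9.postB_SPdamp.c 1 ≤ cosLoQ B.a2hi ∧ WSCC9.postB_SPdamp.c 2 ≤ cosLoQ B.a3hi := by
  simp only [sideOK, Bool.and_eq_true, decide_eq_true_eq] at h
  obtain ⟨⟨⟨⟨⟨⟨⟨h1, h2⟩, h3⟩, h4⟩, h5⟩, h6⟩, h7⟩, h8⟩ := h
  exact ⟨⟨h1, h2, h3⟩, ⟨h4, h5, h6⟩, h7, h8⟩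

/-- **The recast state of every `x ∈ B` lies in `zbox B`** (coordinatewise, in the `SOS.vars` assignment used by the
Bench decls), for every `δs` with `EqData δs`, provided `sideOK`. [folklore] -/
theorem Z_mem_zbox (B : KBox) (hside : B.sideOK = true) {δs : Fin 3 → ℝ} (hEq : WSCC9.postB_SPdamp.EqData δs)
    {x : ClassicalSwing.State 3} (hx : x ∈ B.toSet) (j : ℕ) :
    vars (List.ofFn (deg2_A_SPdampH12_Z δs x)) j ∈ ((B.zbox).getD j (NonemptyInterval.pure (0 : ℚ))).ratCast ℝ := by
  obtain ⟨⟨h20, h21, h22⟩, ⟨h30, h31, h32⟩, hc2, hc3⟩ := sideOK_spec hside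
  obtain ⟨⟨ha2l, ha2u⟩, ⟨ha3l, ha3u⟩, hv⟩ := (B.mem_toSet_iff x).1 hx
  obtain ⟨hα20, hα2π, hsin2, hcos2, hα2e⟩ := angleOf_mem 0
  obtain ⟨hα30, hα3π, hsin3, hcos3, hα3e⟩ := angleOf_mem 1
  have e2 := sin_cos_u_eq hEq x 0
  have e3 := sin_cos_u_eq hEq x 1
  simp only [Fin.succ_zero_eq_one] at e2 hα20 hα2π hsin2 hcos2 hα2e
  simp only [Fin.succ_one_eq_two] at e3 hα30 hα3π hsin3 hcos3 hα3e
  have k2 := sig_kap_mem circle_facts.1.1 circle_facts.1.2.1 hα20 hα2π hsin2 hcos2 hα2e h20 h21 h22 hc2 ha2l ha2u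
  have k3 := sig_kap_mem circle_facts.2.1 circle_facts.2.2.1 hα30 hα3π hsin3 hcos3 hα3e h30 h31 h32 hc3 ha3l ha3u
  refine vars_mem_getD _ _ (by simp [zbox]) ?_ j
  intro i hi
  have hi7 : i < 7 := by simpa using hi
  interval_cases i
  · simpa [zbox, e2.1] using k2.1
  · simpa [zbox, e2.2] using k2.2
  · simpa [zbox, e3.1] using k3.1
  · simpa [zbox, e3.2] using k3.2
  · simpa [zbox] using mem_mkI (hv 0).1 (hv 0).2
  · simpa [zbox] using mem_mkI (hv 1).1 (hv 1).2
  · simpa [zbox] using mem_mkI (hv 2).1 (hv 2).2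

/-- **Soundness of the kernel test.** If `checkLe B V c` holds then `V ≤ c` at the recast state of every `x ∈ B`
(any `δs` with `EqData δs`). [folklore] -/
theorem eval_le_of_checkLe (B : KBox) {V : Poly} {c : ℚ} (h : B.checkLe V c = true) {δs : Fin 3 → ℝ}
    (hEq : WSCC9.postB_SPdamp.EqData δs) {x : ClassicalSwing.State 3} (hx : x ∈ B.toSet) :
    Poly.eval (vars (List.ofFn (deg2_A_SPdampH12_Z δs x))) V ≤ (c : ℝ) := by
  simp only [checkLe, Bool.and_eq_true, decide_eq_true_eq] at h
  exact Poly.eval_le_of_iencl (Z_mem_zbox B h.1 hEq hx) V h.2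

/-- **No pole-slip window on a side-OK box**: with the canonical angles `postB_SPdamp.angleOf`, every state of the box
has relative-angle deviations `|u_i| < π` (indeed `u_i ∈ [−π/2, 1]`). [folklore] -/
theorem abs_u_lt_pi (B : KBox) (hside : B.sideOK = true) {x : ClassicalSwing.State 3} (hx : x ∈ B.toSet) (i : Fin 2) :
    |RecastData.u WSCC9.postB_SPdamp.angleOf x i.succ| < π := by
  obtain ⟨⟨h20, h21, h22⟩, ⟨h30, h31, h32⟩, -, -⟩ := sideOK_spec hside
  obtain ⟨⟨ha2l, ha2u⟩, ⟨ha3l, ha3u⟩, -⟩ := (B.mem_toSet_iff x).1 hx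
  obtain ⟨hα0, hαπ, -, -, -⟩ := angleOf_mem i
  have hπ := Real.pi_gt_three
  rw [abs_lt]
  fin_cases i
  · change -π < RecastData.u WSCC9.postB_SPdamp.angleOf x 1 ∧ RecastData.u WSCC9.postB_SPdamp.angleOf x 1 < π
    change 0 ≤ WSCC9.postB_SPdamp.angleOf 1 at hα0
    change WSCC9.postB_SPdamp.angleOf 1 ≤ π / 2 at hαπ
    simp only [RecastData.u, angleOf_zero, sub_zero]
    have : (0 : ℝ) ≤ B.a2lo := by exact_mod_cast h20
    have : (B.a2hi : ℝ) ≤ 1 := by exact_mod_cast h22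
    constructor <;> linarith
  · change -π < RecastData.u WSCC9.postB_SPdamp.angleOf x 2 ∧ RecastData.u WSCC9.postB_SPdamp.angleOf x 2 < π
    change 0 ≤ WSCC9.postB_SPdamp.angleOf 2 at hα0
    change WSCC9.postB_SPdamp.angleOf 2 ≤ π / 2 at hαπ
    simp only [RecastData.u, angleOf_zero, sub_zero]
    have : (0 : ℝ) ≤ B.a3lo := by exact_mod_cast h30
    have : (B.a3hi : ℝ) ≤ 1 := by exact_mod_cast h32
    constructor <;> linarith

end KBox

end Summit.Ventures.GridStability.Bench.WSCC9

end
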